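import Summits.QuantumFields.YangMills.Theorems.BalabanUVNodesN15CovariantLandauPropagatorRowsReg335
import Summits.QuantumFields.YangMills.Theorems.BalabanUVNodesN15SmallFieldSiteLayerAnyPropagatorRate
import Summits.QuantumFields.YangMills.Theorems.BalabanUVNodesN15SmallFieldUnitLayerAnyPropagatorRate
import Summits.QuantumFields.YangMills.Theorems.BalabanUVNodesN15OnePropagatorAllLayersKnit
import HarnessLib

/-!
# N15 = NE2 — dag-n15-a g32 (t2), F6: ★★★ THE ROAD-(c) LITERAL WITH dag-n15-c's (P-R) PROPAGATOR `X_r` — Bałaban's WHOLE covariant summand `a·Q*(U)Q(U) − D_U(I − R(U))D*_U` live INSIDE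
# the propagator — IN ALL THREE LAYERS, MODULO the (P-R) entries' row `hE` and n15-c∕211's THREE GLOBAL LANDAU ROWS `hG` (both displayed exactly as in 211); `Live ∧ N15At`, pinned threshold,
# keyed face
# (dag-n15-a g32, (t2) FILE F6; node N15 = NE2; `--supports stmt-QuantumFields-27366 --as helper`, count-neutral; 4 plumbing defs + theorems; imports F5, (𝟙P-c′), (𝟙P-d′), (𝟙P-f))

WHY.  PROGRAMME 𝟙P made the site ∕ unit sandwiches and the all-layers literal generic in the inner propagator family ((𝟙P-f) `sfObjects₆qv`: dag-n15-c's (P-Q) propagator `X_q`, covariant AVERAGING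
summand live, Landau summand flat).  dag-n15-c's PROGRAMME (P-R) (g22, 197–211) typed Bałaban's Landau summand `D_U R(U) D*_U` covariantly in the model and proved the OPERATOR layer for the
glued family whose entry 0 carries the whole covariant summand (207 `ne2PlusOperator_sfqr`; 211 `ne2PlusOperator_sfqr_of_global` from ONE global row per grid for `N_V^R` and one for its
η-defect, `hG`, and the entries-1–3 row `hE`).  This file is the (P-R) instance of the one-propagator socket: the SAME propagator `X_r` (207a `sfqrEntry0`'s pair, named `sfqrXc`∕`sfqrXf`
here, `sfqrEntry0 = 𝔇(sfqrXf, sfqrXc)` by `rfl`) inside the site ∕ unit sandwiches ((𝟙P-c′)∕(𝟙P-d′) at `γ_X = min γ_R (1∕16)` via (t2) F5 `rows_sfqr`), knitted with 211's operator layer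
into `sfObjects₇qvr E`, under the SAME displayed hypotheses `hE`, `hG` as 211 — letter for letter — so that ONE Landau family feeds all three layers.

WHAT.  §1 defs `sfqrXc`, `sfqrXf`; `sfqrEntry0_eq_idef_sfqrX` (`rfl`); `qvCov_rows_sf_rate` ((Q-6b)'s averaging rows at any exponent `≤ 1∕16`); `rows_sfqrX` (F5 at the named family).
§2 ★★ `ne2PlusSite_foSiteAny_sfqr`, ★★ `ne2PlusUnit_foCovAnyLam_sfqr` (the node's 2nd ∕ 3rd conjuncts BY NAME for the sandwiches reading `X_r`, given `hG`'s body).  §3 def `sfObjects₇qvr hL E …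
c35 p w`; ★★★ `exists_live_and_n15At_sfObjects₇qvr … E (hE) (hG) … : ∃ w, Live ∧ N15At`; def `wQ7` (pinned threshold); ★★★ `live_and_n15At_sfObjects₇qvr_wQ7`; keyed face
`s_N15_of_admits_sf₇qvr` (part 30's interface, `ne2At` a binder, `hadm` + value equation hypotheses).

HONEST FRAMING ∕ LIMITS.  TWO displayed families remain, exactly dag-n15-c∕211's: `hE` — the rows of the (P-R) family's entries 1–3 (the covariant-gradient ∕ Laplacian η-defects of `X_r`,
NOT constructed in the tree: n15-c's 193b-analogue for (P-R) pins `E` and discharges `hE` later; then a v1.1 of this file drops both, as (Q-7) v1.1 did) — and `hG` — the three cut-off-free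
Landau rows (dag-n15-c's located-next analytic object: sup-norm kernel rows for the covariant Green families, [B9] §1∕(3.49); NOT proved anywhere in the lane yet).  MODEL carriers ∕ operators
(doubled torus `2L^{m+1}`, `L ≥ 7`, global small-field gauge, `Q(U)` = main term (125) of [B7] (124), King-block-mean pairing, `Reg336` idle in the model, crude constants, `Classical.choose`
threshold); the η-rate inequalities are quantifier TEMPLATES — NOT [B9] Thms 3.1 ∕ 3.2 ∕ 3.15 AS PRINTED; NE2⁺ NOT PRINTED.  N15 stays DISCHARGED OF RECORD 8∕28 AS CONSUMED (U-blind v7 pin,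
p687738) — no re-pin asked, nothing re-claimed, no count moved; K3⁸ OPEN; finite 𝕋⁴ per index — NOT ℝ⁴ ∕ OS ∕ mass gap ∕ Clay.  Plumbing `def`s ⇒ review ∕ audit lane.
`set_option maxRecDepth 8192 in` ×2 (the `rfl`∕`unfold` through 207a's and F5's large terms, as (𝟙P-f)).  No `sorry`, `instance`, `notation`; standard axioms.
-/

noncomputable section

open scoped BigOperators Matrix

namespace Summit.QuantumFields.YangMills.BalabanUVNodes.N15.SiteLayerSf

open Literature.MathematicalPhysics.QuantumFieldTheory.Balaban1983to89
open Literature.MathematicalPhysics.QuantumFieldTheory.Balaban1983to89.T4EtaRate (NE2PlusOperator NE2PlusSite NE2PlusUnit rateFactor)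
open Literature.MathematicalPhysics.QuantumFieldTheory.Balaban1983to89.B11SectG (BlockNorm HasMaj)
open Literature.MathematicalPhysics.QuantumFieldTheory.Balaban1983to89.B5Prop11Plancherel (Tor fine)
open Literature.MathematicalPhysics.QuantumFieldTheory.Balaban1983to89.B6UnitTorusCarrier (unitTorusGeo)
open Literature.MathematicalPhysics.QuantumFieldTheory.Balaban1983to89.T4EtaRateDefect (idef)
open Literature.MathematicalPhysics.QuantumFieldTheory.Balaban1983to89.T4EtaRateCoeffDefect (pull)
open Literature.MathematicalPhysics.QuantumFieldTheory.King1986.Torus (blockOf)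
open Literature.Barriers.QuantumFields (traceForm)
open Summit.QuantumFields.YangMills.BalabanUVNodes.N15.BackgroundLayer (gavgM)
open Summit.QuantumFields.YangMills.BalabanUVNodes.N15.VectorPiece (bshiftEquiv kingPrV tensorId)
open Summit.QuantumFields.YangMills.BalabanUVNodes.N15.MatrixSpecies (liftBlk liftMap)
open Summit.QuantumFields.YangMills.BalabanUVNodes.N15.TwoGrid (gOp)
open Summit.QuantumFields.YangMills.BalabanUVNodes.N15.Gluing (SfIdx sfGeo sfInstance sfFamily sfqrFamily sfqrEntry0 CvX CvX' cvM cvBlk CvNorm cvNL cvNL' cvGlued cvGlued' cvNVq cvNVq' cvNVr cvNVr'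
  ne2PlusOperator_sfqr_of_global)
open Summit.QuantumFields.YangMills.BalabanUVNodes.N15.OperatorReadout (opGeo)
open Summit.QuantumFields.YangMills.BalabanUVNodes.N15.PairedFamilyGuard (Live)
open Literature.MathematicalPhysics.QuantumFieldTheory.Balaban1983to89.T4Continuum (T4Family ULoop)
open Node00 (NE2Objects₁₁)
open Summit.QuantumFields.YangMills.BalabanUVNodes.N15.AtKeyedHome (s_N15_of_admits)
open YMDAG.UVSplit (Datum RateCarriers RateRecordPred N15At S_N15 ne2OfRecord₁₁)

variable (d : ℕ) {L : ℕ} [NeZero L] (mm ι : Type) [Fintype mm] [DecidableEq mm] [Fintype ι] [DecidableEq ι] (a : ℝ) (e : Matrix mm mm ℂ ≃L[ℝ] (ι → ℝ))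

open scoped Matrix.Norms.L2Operator

/-! ## §1 dag-n15-c's (P-R) propagator `X_r` as a family over the node index and the potential; the averaging rows at any rate; the three rows -/

section Family

/-- **dag-n15-c's LIVE GLUED PROPAGATOR WITH BAŁABAN's WHOLE COVARIANT SUMMAND, COARSE SPACING** `X_r(A′)` — 207a `sfqrEntry0`'s second argument, as a family over `(i, A′)`:
`cvGlued … (e^{ηĀ′}) (P := cvNL − cvNVq(e^{ηĀ′}) − cvNVr(e^{ηĀ′})) (NV := cvNVq(e^{ηĀ′}) + cvNVr(e^{ηĀ′}))`.
[cite: Balaban1985BackgroundPropagators, (3.25)–(3.26) p.395, Thm 3.1 p.397 (shape); Balaban1985Averaging, (124)–(126) p.36] -/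
def sfqrXc (hL : Odd L ∧ 1 < L) (i : SfIdx d L) (A' : Fin (d + 1) → CvX' d L i.m i.kk i.r hL → Matrix mm mm ℂ) :
    (CvX d L i.m i.kk hL × ι → ℝ) →ₗ[ℝ] (CvX d L i.m i.kk hL × ι → ℝ) :=
  cvGlued d L i.m i.kk hL a ((((L ^ i.kk : ℕ) : ℝ))⁻¹) ι e (fun _ _ => (1 : Matrix mm mm ℂ)) (fun μ x => NormedSpace.exp (((((L ^ i.kk : ℕ) : ℝ))⁻¹) • gavgM (Matrix mm mm ℂ) (Fin (d + 1)) (kingPrV L i.kk i.r (cvM d L i.m i.kk hL)) A' μ x)) (cvNL d L i.m i.kk hL a ι - (cvNVq d L i.m i.kk hL a ι e (fun μ x => NormedSpace.exp (((((L ^ i.kk : ℕ) : ℝ))⁻¹) • gavgM (Matrix mm mm ℂ) (Fin (d + 1)) (kingPrV L i.kk i.r (cvM d L i.m i.kk hL)) A' μ x))) - (cvNVr d L i.m i.kk hL a ι e (fun μ x => NormedSpace.exp (((((L ^ i.kk : ℕ) : ℝ))⁻¹) • gavgM (Matrix mm mm ℂ) (Fin (d + 1)) (kingPrV L i.kk i.r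 (cvM d L i.m i.kk hL)) A' μ x)))) (fun _ => (cvNVq d L i.m i.kk hL a ι e (fun μ x => NormedSpace.exp (((((L ^ i.kk : ℕ) : ℝ))⁻¹) • gavgM (Matrix mm mm ℂ) (Fin (d + 1)) (kingPrV L i.kk i.r (cvM d L i.m i.kk hL)) A' μ x))) + (cvNVr d L i.m i.kk hL a ι e (fun μ x => NormedSpace.exp (((((L ^ i.kk : ℕ) : ℝ))⁻¹) • gavgM (Matrix mm mm ℂ) (Fin (d + 1)) (kingPrV L i.kk i.r (cvM d L i.m i.kk hL)) A' μ x))))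

/-- **THE SAME AT THE FINE SPACING** `X′_r(A′)` — 207a `sfqrEntry0`'s first argument. [cite: Balaban1985BackgroundPropagators, (3.25)–(3.26) p.395, Thm 3.1 p.397 (shape)] -/
def sfqrXf (hL : Odd L ∧ 1 < L) (i : SfIdx d L) (A' : Fin (d + 1) → CvX' d L i.m i.kk i.r hL → Matrix mm mm ℂ) :
    (CvX' d L i.m i.kk i.r hL × ι → ℝ) →ₗ[ℝ] (CvX' d L i.m i.kk i.r hL × ι → ℝ) :=
  cvGlued' d L i.m i.kk i.r hL a ((((L ^ i.r * L ^ i.kk : ℕ) : ℝ))⁻¹) ι e (fun _ _ => (1 : Matrix mm mm ℂ)) (fun μ x' => NormedSpace.exp (((((L ^ i.r * L ^ i.kk : ℕ) : ℝ))⁻¹) • A' μ x')) (cvNL' d L i.m i.kk i.r hL a ι - (cvNVq' d L i.m i.kk i.r hL a ι e (fun μ x' => NormedSpace.exp (((((L ^ i.r * L ^ i.kk : ℕ) : ℝ))⁻¹) • A' μ x'))) - (cvNVr' d L i.m i.kk i.r hL a ι e (fun μ x' => NormedSpace.exp (((((L ^ i.r * L ^ i.kk : ℕ) : ℝ))⁻¹)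 • A' μ x')))) (fun _ => (cvNVq' d L i.m i.kk i.r hL a ι e (fun μ x' => NormedSpace.exp (((((L ^ i.r * L ^ i.kk : ℕ) : ℝ))⁻¹) • A' μ x'))) + (cvNVr' d L i.m i.kk i.r hL a ι e (fun μ x' => NormedSpace.exp (((((L ^ i.r * L ^ i.kk : ℕ) : ℝ))⁻¹) • A' μ x'))))

set_option maxRecDepth 8192 in
/-- ★ **ONE PROPAGATOR**: the (P-R) operator layer's entry 0 (207a `sfqrEntry0`, the η-defect row of (3.42)) IS the two-grid defect of EXACTLY the pair `(sfqrXf, sfqrXc)` the site ∕ unit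
sandwiches of §2 read — `rfl`. [bookkeeping] -/
theorem sfqrEntry0_eq_idef_sfqrX (hL : Odd L ∧ 1 < L) (i : SfIdx d L) (A' : Fin (d + 1) → CvX' d L i.m i.kk i.r hL → Matrix mm mm ℂ) :
    sfqrEntry0 d mm ι a e hL i A' = idef (pull (liftMap (kingPrV L i.kk i.r (cvM d L i.m i.kk hL)) ι)) (pull (liftMap (kingPrV L i.kk i.r (cvM d L i.m i.kk hL)) ι)) (sfqrXf d mm ι a e hL i A') (sfqrXc d mm ι a e hL i A') := by
  unfold sfqrEntry0 sfqrXf sfqrXc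
  rfl

variable {d mm ι a e}

/-- ★ **(Q-6b)'s SIX AVERAGING ROWS AT ANY TWO-GRID EXPONENT `γ_X ≤ 1∕16`**: `qvCov_rows_sf` (comparison rows at `(L^k)^{−1∕16}`) weakened by `(L^k)^{−1∕16} ≤ (L^k)^{−γ_X}` (`L^k ≥ 1`) —
the `hfam` of (𝟙P-c′)∕(𝟙P-d′). [cite: Balaban1985BackgroundPropagators, (3.80)–(3.81) p.406 (shape); Balaban1985Averaging, (124)–(126) p.36] -/
theorem qvCov_rows_sf_rate [Nonempty mm] (hL : Odd L ∧ 1 < L) {c35 : ℝ} (hc35 : 0 ≤ c35) {γX : ℝ} (hγX16 : γX ≤ 1 / 16) :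
    ∀ ρ : ℝ, 0 < ρ → ∃ KD s₀ : ℝ, 0 ≤ KD ∧ 0 < s₀ ∧
      ∀ (i : SfIdx d L) (α₀ : ℝ) (A' : Fin (d + 1) → CvX' d L i.m i.kk i.r hL → Matrix mm mm ℂ), 0 < α₀ → c35 * (L : ℝ) ^ i.m * α₀ ≤ s₀ → (sfInstance d mm ι hL i).Bf.Reg335 c35 α₀ A' →
        HasMaj (CvNorm d L i.m i.kk hL ι) (BlockNorm.ofBlocks (unitTorusGeo L i.kk (cvM d L i.m i.kk hL)) (liftBlk (fun b : Tor (cvM d L i.m i.kk hL) × Fin (d + 1) => b.1) ι)) (qDc d mm ι e hL i A')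
          (fun y y' => KD * (c35 * (L : ℝ) ^ i.m * α₀) * Real.exp (-(ρ * (unitTorusGeo L i.kk (cvM d L i.m i.kk hL)).dist y y'))) ∧
        HasMaj (BlockNorm.ofBlocks (unitTorusGeo L i.kk (cvM d L i.m i.kk hL)) (liftBlk (fun b : CvX' d L i.m i.kk i.r hL => blockOf (L ^ i.r * L ^ i.kk) (cvM d L i.m i.kk hL) b.1) ι)) (BlockNorm.ofBlocks (unitTorusGeo L i.kk (cvM d L i.m i.kk hL)) (liftBlk (fun b : Tor (cvM d L i.m i.kk hL) × Fin (d + 1) => b.1) ι)) (qDf d mm ι e hL i A')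
          (fun y y' => KD * (c35 * (L : ℝ) ^ i.m * α₀) * Real.exp (-(ρ * (unitTorusGeo L i.kk (cvM d L i.m i.kk hL)).dist y y'))) ∧
        HasMaj (BlockNorm.ofBlocks (unitTorusGeo L i.kk (cvM d L i.m i.kk hL)) (liftBlk (fun b : Tor (cvM d L i.m i.kk hL) × Fin (d + 1) => b.1) ι)) (CvNorm d L i.m i.kk hL ι) (qEc d mm ι e hL i A')
          (fun y y' => KD * (c35 * (L : ℝ) ^ i.m * α₀) * Real.exp (-(ρ * (unitTorusGeo L i.kk (cvM d L i.m i.kk hL)).dist y y'))) ∧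
        HasMaj (BlockNorm.ofBlocks (unitTorusGeo L i.kk (cvM d L i.m i.kk hL)) (liftBlk (fun b : Tor (cvM d L i.m i.kk hL) × Fin (d + 1) => b.1) ι)) (BlockNorm.ofBlocks (unitTorusGeo L i.kk (cvM d L i.m i.kk hL)) (liftBlk (fun b : CvX' d L i.m i.kk i.r hL => blockOf (L ^ i.r * L ^ i.kk) (cvM d L i.m i.kk hL) b.1) ι)) (qEf d mm ι e hL i A')
          (fun y y' => KD * (c35 * (L : ℝ) ^ i.m * α₀) * Real.exp (-(ρ * (unitTorusGeo L i.kk (cvM d L i.m i.kk hL)).dist y y'))) ∧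
        HasMaj (CvNorm d L i.m i.kk hL ι) (BlockNorm.ofBlocks (unitTorusGeo L i.kk (cvM d L i.m i.kk hL)) (liftBlk (fun b : Tor (cvM d L i.m i.kk hL) × Fin (d + 1) => b.1) ι)) (qDf d mm ι e hL i A' ∘ₗ pull (liftMap (kingPrV L i.kk i.r (cvM d L i.m i.kk hL)) ι) - qDc d mm ι e hL i A')
          (fun y y' => KD * ((((L ^ i.kk : ℕ) : ℝ)) ^ (-γX)) * Real.exp (-(ρ * (unitTorusGeo L i.kk (cvM d L i.m i.kk hL)).dist y y'))) ∧
        HasMaj (BlockNorm.ofBlocks (unitTorusGeo L i.kk (cvM d L i.m i.kk hL)) (liftBlk (fun b : Tor (cvM d L i.m i.kk hL) × Fin (d + 1) => b.1) ι)) (BlockNorm.ofBlocks (unitTorusGeo L i.kk (cvM d L i.m i.kk hL)) (liftBlk (fun b : CvX' d L i.m i.kk i.r hL => blockOf (L ^ i.r * L ^ i.kk) (cvM d L i.m i.kk hL) b.1) ι)) (qEf d mm ι e hL i A' - pull (liftMap (kingPrV L i.kk i.r (cvM d L i.m i.kk hL)) ι) ∘ₗ qEc d mm ι e hL i A')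
          (fun y y' => KD * ((((L ^ i.kk : ℕ) : ℝ)) ^ (-γX)) * Real.exp (-(ρ * (unitTorusGeo L i.kk (cvM d L i.m i.kk hL)).dist y y'))) := by
  intro ρ hρ
  obtain ⟨KD, s₀, hKD, hs₀, H⟩ := qvCov_rows_sf d mm ι e hL hc35 ρ hρ
  refine ⟨KD, s₀, hKD, hs₀, fun i α₀ A' hα₀ hs hA' => ?_⟩
  obtain ⟨h1, h2, h3, h4, h5, h6⟩ := H i α₀ A' hα₀ hs hA'
  have hLpos : 0 < L := Nat.pos_of_ne_zero (NeZero.ne L)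
  have hx1 : (1 : ℝ) ≤ (((L ^ i.kk : ℕ) : ℝ)) := by exact_mod_cast Nat.one_le_pow _ _ hLpos
  have h16 : (((L ^ i.kk : ℕ) : ℝ)) ^ (-(1 / 16 : ℝ)) ≤ (((L ^ i.kk : ℕ) : ℝ)) ^ (-γX) := Real.rpow_le_rpow_of_exponent_le hx1 (neg_le_neg hγX16)
  have hw : ∀ y y' : Tor (cvM d L i.m i.kk hL), KD * ((((L ^ i.kk : ℕ) : ℝ)) ^ (-(1 / 16 : ℝ))) * Real.exp (-(ρ * (unitTorusGeo L i.kk (cvM d L i.m i.kk hL)).dist y y')) ≤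
      KD * ((((L ^ i.kk : ℕ) : ℝ)) ^ (-γX)) * Real.exp (-(ρ * (unitTorusGeo L i.kk (cvM d L i.m i.kk hL)).dist y y')) := fun y y' =>
    mul_le_mul_of_nonneg_right (mul_le_mul_of_nonneg_left h16 hKD) (Real.exp_nonneg _)
  exact ⟨h1, h2, h3, h4, h5.mono hw, h6.mono hw⟩

set_option maxRecDepth 8192 in
/-- ★★ (t2) F5 `rows_sfqr` AT THE NAMED FAMILY: `(sfqrXc, sfqrXf)` meets (𝟙P-c′)'s three displayed rows under the class at `γ_X = min γ_R (1∕16)`, given n15-c∕211's three global Landau rows.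
[cite: Balaban1985BackgroundPropagators, (3.35) p.396, (3.49) p.398, (3.62)–(3.65) pp.402–403 (shape)] -/
theorem rows_sfqrX [Nonempty ι] [Nonempty mm] (hL : Odd L ∧ 1 < L) (hL7 : 7 ≤ L) (ha : 0 < a) {c35 : ℝ} (hc35 : 0 < c35) (he : ∀ A B : Matrix mm mm ℂ, traceForm A B = e A ⬝ᵥ e B)
    {δR cR CR γR : ℝ} (hδR : 0 < δR) (hcR : 0 ≤ cR) (hCR : 0 ≤ CR)
    (hG : ∀ i : SfIdx d L, ∀ α₀ : ℝ, 0 < α₀ → ∀ A' : Fin (d + 1) → CvX' d L i.m i.kk i.r hL → Matrix mm mm ℂ, (sfInstance d mm ι hL i).Bf.Reg335 c35 α₀ A' →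
        HasMaj (CvNorm d L i.m i.kk hL ι) (CvNorm d L i.m i.kk hL ι) (cvNVr d L i.m i.kk hL a ι e (fun μ x => NormedSpace.exp (((((L ^ i.kk : ℕ) : ℝ))⁻¹) • gavgM (Matrix mm mm ℂ) (Fin (d + 1)) (kingPrV L i.kk i.r (cvM d L i.m i.kk hL)) A' μ x))) (fun y y' => (cR * (c35 * (L : ℝ) ^ i.m * α₀)) * Real.exp (-(δR * (unitTorusGeo L i.kk (cvM d L i.m i.kk hL)).dist y y'))) ∧
        HasMaj (BlockNorm.ofBlocks (unitTorusGeo L i.kk (cvM d L i.m i.kk hL)) (liftBlk (cvBlk d L i.m i.kk hL ∘ (kingPrV L i.kk i.r (cvM d L i.m i.kk hL))) ι)) (BlockNorm.ofBlocks (unitTorusGeo L i.kk (cvM d L i.m i.kk hL)) (liftBlk (cvBlk d L i.m i.kk hL ∘ (kingPrV L i.kk i.r (cvM d L i.m i.kk hL))) ι)) (cvNVr' d L i.m i.kk i.r hL a ι e (fun μ x' => NormedSpace.exp (((((L ^ i.r * L ^ i.kk : ℕ) : ℝ))⁻¹) • A' μ x'))) (fun y y' => (cR * (c35 * (L : ℝ)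 ^ i.m * α₀)) * Real.exp (-(δR * (unitTorusGeo L i.kk (cvM d L i.m i.kk hL)).dist y y'))) ∧
        HasMaj (CvNorm d L i.m i.kk hL ι) (BlockNorm.ofBlocks (unitTorusGeo L i.kk (cvM d L i.m i.kk hL)) (liftBlk (cvBlk d L i.m i.kk hL ∘ (kingPrV L i.kk i.r (cvM d L i.m i.kk hL))) ι)) (idef (pull (liftMap (kingPrV L i.kk i.r (cvM d L i.m i.kk hL)) ι)) (pull (liftMap (kingPrV L i.kk i.r (cvM d L i.m i.kk hL)) ι)) (cvNVr' d L i.m i.kk i.r hL a ι e (fun μ x' => NormedSpace.exp (((((L ^ i.r * L ^ i.kk : ℕ) : ℝ))⁻¹) • A' μ x'))) (cvNVr d L i.m i.kk hL a ι e (fun μ x => NormedSpace.exp (((((L ^ i.kk : ℕ) : ℝ))⁻¹) • gavgM (Matrix mm mm ℂ) (Fin (d + 1)) (kingPrV L i.kk i.r (cvM d L i.m i.kk hL)) A' μ x)))) (fun y y' => (CR * ((L : ℝ) ^ i.kk) ^ (-γR)) * Real.exp (-(δR * (unitTorusGeo L i.kk (cvM d L i.m i.kk hL)).dist y y')))) 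:
    ∃ ρX KX wX sX : ℝ, 0 < ρX ∧ 0 ≤ KX ∧ 0 < sX ∧
      ∀ (i : SfIdx d L) (α₀ : ℝ) (A' : Fin (d + 1) → CvX' d L i.m i.kk i.r hL → Matrix mm mm ℂ), 0 < α₀ → wX ≤ ((L ^ i.m : ℕ) : ℝ) → c35 * (L : ℝ) ^ i.m * α₀ ≤ sX →
        (sfInstance d mm ι hL i).Bf.Reg335 c35 α₀ A' →
        HasMaj (CvNorm d L i.m i.kk hL ι) (CvNorm d L i.m i.kk hL ι) (sfqrXc d mm ι a e hL i A' - tensorId ι (gOp (cvM d L i.m i.kk hL) (L ^ i.kk) a))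
          (fun y y' => KX * (c35 * (L : ℝ) ^ i.m * α₀) * Real.exp (-(ρX * (unitTorusGeo L i.kk (cvM d L i.m i.kk hL)).dist y y'))) ∧
        HasMaj (BlockNorm.ofBlocks (unitTorusGeo L i.kk (cvM d L i.m i.kk hL)) (liftBlk (fun b : CvX' d L i.m i.kk i.r hL => blockOf (L ^ i.r * L ^ i.kk) (cvM d L i.m i.kk hL) b.1) ι)) (BlockNorm.ofBlocks (unitTorusGeo L i.kk (cvM d L i.m i.kk hL)) (liftBlk (fun b : CvX' d L i.m i.kk i.r hL => blockOf (L ^ i.r * L ^ i.kk) (cvM d L i.m i.kk hL) b.1) ι)) (sfqrXf d mm ι a e hL i A' - tensorId ι (gOp (cvM d L i.m i.kk hL) (L ^ i.r * L ^ i.kk) a))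
          (fun y y' => KX * (c35 * (L : ℝ) ^ i.m * α₀) * Real.exp (-(ρX * (unitTorusGeo L i.kk (cvM d L i.m i.kk hL)).dist y y'))) ∧
        HasMaj (CvNorm d L i.m i.kk hL ι) (BlockNorm.ofBlocks (unitTorusGeo L i.kk (cvM d L i.m i.kk hL)) (liftBlk (fun b : CvX' d L i.m i.kk i.r hL => blockOf (L ^ i.r * L ^ i.kk) (cvM d L i.m i.kk hL) b.1) ι))
          (idef (pull (liftMap (kingPrV L i.kk i.r (cvM d L i.m i.kk hL)) ι)) (pull (liftMap (kingPrV L i.kk i.r (cvM d L i.m i.kk hL)) ι)) (sfqrXf d mm ι a e hL i A' - tensorId ι (gOp (cvM d L i.m i.kk hL) (L ^ i.r * L ^ i.kk) a)) (sfqrXc d mm ι a e hL i A' - tensorId ι (gOp (cvM d L i.m i.kk hL) (L ^ i.kk) a)))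
          (fun y y' => KX * ((((L ^ i.kk : ℕ) : ℝ)) ^ (-(min γR (1 / 16)))) * Real.exp (-(ρX * (unitTorusGeo L i.kk (cvM d L i.m i.kk hL)).dist y y'))) := by
  unfold sfqrXc sfqrXf
  exact rows_sfqr hL hL7 ha hc35 he hδR hcR hCR hG

end Family

/-! ## §2 The node's site and unit conjuncts BY NAME with `X_r` inside the sandwich, given the three global Landau rows -/

section Layers

variable [Nonempty mm]

/-- ★★ **`NE2PlusSite` FOR dag-n15-c's CLASS, THE SITE SANDWICH READING `X_r`** (covariant averaging `Q⊗1 + D` outside AND Bałaban's whole covariant summand live INSIDE the propagator), GIVEN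
n15-c∕211's three global Landau rows: (𝟙P-c′) `ne2PlusSite_foSiteAny_rate` at `(sfqrXc, sfqrXf)`, `γ_X = min γ_R (1∕16)`, with `rows_sfqrX` and `qvCov_rows_sf_rate`.  MODEL; the Landau
rows are HYPOTHESES; NOT [B9] Thm 3.2 as printed.
[cite: Balaban1985BackgroundPropagators, Thm 3.2 (3.47)–(3.48) p.398 («with the same constants»), (3.25)–(3.26) p.395, (3.49) p.398, (3.80)–(3.81) p.406 (shape: MODEL level)] -/
theorem ne2PlusSite_foSiteAny_sfqr [Nonempty ι] (hL : Odd L ∧ 1 < L) (hL7 : 7 ≤ L) (ha : 0 < a) {c35 : ℝ} (hc35 : 0 < c35)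
    (he : ∀ A B : Matrix mm mm ℂ, traceForm A B = e A ⬝ᵥ e B) {δR cR CR γR : ℝ} (hδR : 0 < δR) (hcR : 0 ≤ cR) (hCR : 0 ≤ CR) (hγR : 0 < γR)
    (hG : ∀ i : SfIdx d L, ∀ α₀ : ℝ, 0 < α₀ → ∀ A' : Fin (d + 1) → CvX' d L i.m i.kk i.r hL → Matrix mm mm ℂ, (sfInstance d mm ι hL i).Bf.Reg335 c35 α₀ A' →
        HasMaj (CvNorm d L i.m i.kk hL ι) (CvNorm d L i.m i.kk hL ι) (cvNVr d L i.m i.kk hL a ι e (fun μ x => NormedSpace.exp (((((L ^ i.kk : ℕ) : ℝ))⁻¹) • gavgM (Matrix mm mm ℂ) (Fin (d + 1)) (kingPrV L i.kk i.r (cvM d L i.m i.kk hL)) A' μ x))) (fun y y' => (cR * (c35 * (L : ℝ) ^ i.m * α₀)) * Real.exp (-(δR * (unitTorusGeo L i.kk (cvM d L i.m i.kk hL)).dist y y'))) ∧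
        HasMaj (BlockNorm.ofBlocks (unitTorusGeo L i.kk (cvM d L i.m i.kk hL)) (liftBlk (cvBlk d L i.m i.kk hL ∘ (kingPrV L i.kk i.r (cvM d L i.m i.kk hL))) ι)) (BlockNorm.ofBlocks (unitTorusGeo L i.kk (cvM d L i.m i.kk hL)) (liftBlk (cvBlk d L i.m i.kk hL ∘ (kingPrV L i.kk i.r (cvM d L i.m i.kk hL))) ι)) (cvNVr' d L i.m i.kk i.r hL a ι e (fun μ x' => NormedSpace.exp (((((L ^ i.r * L ^ i.kk : ℕ) : ℝ))⁻¹) • A' μ x'))) (fun y y' => (cR * (c35 * (L : ℝ) ^ i.m * α₀)) * Real.exp (-(δR * (unitTorusGeo L i.kk (cvM d L i.m i.kk hL)).dist y y'))) ∧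
        HasMaj (CvNorm d L i.m i.kk hL ι) (BlockNorm.ofBlocks (unitTorusGeo L i.kk (cvM d L i.m i.kk hL)) (liftBlk (cvBlk d L i.m i.kk hL ∘ (kingPrV L i.kk i.r (cvM d L i.m i.kk hL))) ι)) (idef (pull (liftMap (kingPrV L i.kk i.r (cvM d L i.m i.kk hL)) ι)) (pull (liftMap (kingPrV L i.kk i.r (cvM d L i.m i.kk hL)) ι)) (cvNVr' d L i.m i.kk i.r hL a ι e (fun μ x' => NormedSpace.exp (((((L ^ i.r * L ^ i.kk : ℕ) : ℝ))⁻¹) • A' μ x'))) (cvNVr d L i.m i.kk hL a ι e (fun μ x => NormedSpace.exp (((((L ^ i.kk : ℕ) : ℝ))⁻¹) • gavgM (Matrix mm mm ℂ) (Fin (d + 1)) (kingPrV L i.kk i.r (cvM d L i.m i.kk hL)) A' μ x)))) (fun y y' => (CR * ((L : ℝ) ^ i.kk) ^ (-γR)) * Real.exp (-(δR * (unitTorusGeo L i.kk (cvM d L i.m i.kk hL)).dist y y'))))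
    (α β : Fin (d + 1)) (j j' : ι) (d' : ℕ) (p : ℝ) :
    NE2PlusSite d' p c35 (sfInstance d mm ι hL) (foSiteAny d mm ι a hL α β j j' (sfqrXc d mm ι a e hL) (sfqrXf d mm ι a e hL) (qDc d mm ι e hL) (qEc d mm ι e hL) (qDf d mm ι e hL) (qEf d mm ι e hL)) :=
  ne2PlusSite_foSiteAny_rate d mm ι a hL hL7 ha hc35 α β j j' d' p _ _ _ _ _ _ (lt_min hγR (by norm_num)) (min_le_right _ _)
    (rows_sfqrX hL hL7 ha hc35 he hδR hcR hCR hG) (qvCov_rows_sf_rate hL hc35.le (min_le_right _ _))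

/-- ★★ **`NE2PlusUnit` FOR dag-n15-c's CLASS, THE DIRICHLET UNIT LAYER READING `X_r`** above a size threshold `w` (`d ≥ 1`), GIVEN the three global Landau rows: (𝟙P-d′)
`ne2PlusUnit_foCovAnyLam_rate` at `(sfqrXc, sfqrXf)`, `γ_X = min γ_R (1∕16)` (`θ = L^{−γ_X}`).  MODEL; NOT [B9] Thm 3.15 as printed.
[cite: Balaban1985BackgroundPropagators, Thm 3.15 (3.187) p.432, (3.25)–(3.26) p.395, (3.49) p.398, (3.80)–(3.81) p.406 (shape: MODEL level)] -/
theorem ne2PlusUnit_foCovAnyLam_sfqr [Nonempty ι] (hd : 1 ≤ d) (hL : Odd L ∧ 1 < L) (hL7 : 7 ≤ L) (ha : 0 < a) {c35 : ℝ} (hc35 : 0 < c35)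
    (he : ∀ A B : Matrix mm mm ℂ, traceForm A B = e A ⬝ᵥ e B) {δR cR CR γR : ℝ} (hδR : 0 < δR) (hcR : 0 ≤ cR) (hCR : 0 ≤ CR) (hγR : 0 < γR)
    (hG : ∀ i : SfIdx d L, ∀ α₀ : ℝ, 0 < α₀ → ∀ A' : Fin (d + 1) → CvX' d L i.m i.kk i.r hL → Matrix mm mm ℂ, (sfInstance d mm ι hL i).Bf.Reg335 c35 α₀ A' →
        HasMaj (CvNorm d L i.m i.kk hL ι) (CvNorm d L i.m i.kk hL ι) (cvNVr d L i.m i.kk hL a ι e (fun μ x => NormedSpace.exp (((((L ^ i.kk : ℕ) : ℝ))⁻¹) • gavgM (Matrix mm mm ℂ) (Fin (d + 1)) (kingPrV L i.kk i.r (cvM d L i.m i.kk hL)) A' μ x))) (fun y y' => (cR * (c35 * (L : ℝ) ^ i.m * α₀)) * Real.exp (-(δR * (unitTorusGeo L i.kk (cvM d L i.m i.kk hL)).dist y y'))) ∧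
        HasMaj (BlockNorm.ofBlocks (unitTorusGeo L i.kk (cvM d L i.m i.kk hL)) (liftBlk (cvBlk d L i.m i.kk hL ∘ (kingPrV L i.kk i.r (cvM d L i.m i.kk hL))) ι)) (BlockNorm.ofBlocks (unitTorusGeo L i.kk (cvM d L i.m i.kk hL)) (liftBlk (cvBlk d L i.m i.kk hL ∘ (kingPrV L i.kk i.r (cvM d L i.m i.kk hL))) ι)) (cvNVr' d L i.m i.kk i.r hL a ι e (fun μ x' => NormedSpace.exp (((((L ^ i.r * L ^ i.kk : ℕ) : ℝ))⁻¹) • A' μ x'))) (fun y y' => (cR * (c35 * (L : ℝ) ^ i.m * α₀)) * Real.exp (-(δR * (unitTorusGeo L i.kk (cvM d L i.m i.kk hL)).dist y y'))) ∧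
        HasMaj (CvNorm d L i.m i.kk hL ι) (BlockNorm.ofBlocks (unitTorusGeo L i.kk (cvM d L i.m i.kk hL)) (liftBlk (cvBlk d L i.m i.kk hL ∘ (kingPrV L i.kk i.r (cvM d L i.m i.kk hL))) ι)) (idef (pull (liftMap (kingPrV L i.kk i.r (cvM d L i.m i.kk hL)) ι)) (pull (liftMap (kingPrV L i.kk i.r (cvM d L i.m i.kk hL)) ι)) (cvNVr' d L i.m i.kk i.r hL a ι e (fun μ x' => NormedSpace.exp (((((L ^ i.r * L ^ i.kk : ℕ) : ℝ))⁻¹) • A' μ x'))) (cvNVr d L i.m i.kk hL a ι e (fun μ x => NormedSpace.exp (((((L ^ i.kk : ℕ) : ℝ))⁻¹) • gavgM (Matrix mm mm ℂ) (Fin (d + 1)) (kingPrV L i.kk i.r (cvM d L i.m i.kk hL)) A' μ x)))) (fun y y' => (CR * ((L : ℝ) ^ i.kk) ^ (-γR)) * Real.exp (-(δR * (unitTorusGeo L i.kk (cvM d L i.m i.kk hL)).dist y y'))))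
    (α β : Fin (d + 1)) (j j' : ι) :
    ∃ w : ℝ, NE2PlusUnit c35 (fun i : SfIdxGE d L w × Finset (Fin (d + 1) → ℤ) => sfInstance d mm ι hL i.1.1)
      (fun i => foCovAnyLam d mm ι a hL α β j j' (sfqrXc d mm ι a e hL) (sfqrXf d mm ι a e hL) (qDc d mm ι e hL) (qEc d mm ι e hL) (qDf d mm ι e hL) (qEf d mm ι e hL) i.1.1 i.2)
      (fun i => inLamSf d mm ι hL i.1.1 i.2) (fun i => (sfInstance d mm ι hL i.1.1).gc.dist) :=
  ne2PlusUnit_foCovAnyLam_rate d mm ι a hd hL hL7 ha hc35 α β j j' _ _ _ _ _ _ (lt_min hγR (by norm_num)) (min_le_right _ _)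
    (rows_sfqrX hL hL7 ha hc35 he hδR hcR hCR hG) (qvCov_rows_sf_rate hL hc35.le (min_le_right _ _))

end Layers

/-! ## §3 The all-layers literal with the (P-R) propagator `X_r` in all three layers; pinned threshold; keyed face; trace-form coordinates -/

section Closed

variable [Nonempty mm]

/-- **THE ROAD-(c) LITERAL WITH THE (P-R) PROPAGATOR IN ALL THREE LAYERS** at a size threshold `w`: operator layer `sfqrFamily … (E ·)` (207a: entry 0 = `𝔇(X′_r, X_r)`, entries 1–3 the
consumer's `E`), site kernel (𝟙P-c′) and Dirichlet unit kernel (𝟙P-d′) BOTH reading `(sfqrXc, sfqrXf)` through the constructed covariant averaging `(qDc, qEc, qDf, qEf)`, genuine region `inLamSf`,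
on `SfIdxGE d L w × RegIdx0 d`. [bookkeeping] -/
def sfObjects₇qvr (hL : Odd L ∧ 1 < L) (E : ∀ i : SfIdx d L, Fin 4 → (Fin (d + 1) → CvX' d L i.m i.kk i.r hL → Matrix mm mm ℂ) → ((CvX d L i.m i.kk hL × ι → ℝ) →ₗ[ℝ] (CvX' d L i.m i.kk i.r hL × ι → ℝ)))
    (α β : Fin (d + 1)) (j j' : ι) (α' β' : Fin (d + 1)) (j₂ j₂' : ι) (c35 p w : ℝ) : NE2Objects₁₁ :=
  ⟨SfIdxGE d L w × RegIdx0 d, c35, p, fun x => sfInstance d mm ι hL x.1.1, fun x => sfqrFamily d mm ι a e hL x.1.1 (E x.1.1),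
    fun x => foSiteAny d mm ι a hL α β j j' (sfqrXc d mm ι a e hL) (sfqrXf d mm ι a e hL) (qDc d mm ι e hL) (qEc d mm ι e hL) (qDf d mm ι e hL) (qEf d mm ι e hL) x.1.1,
    fun x => foCovAnyLam d mm ι a hL α' β' j₂ j₂' (sfqrXc d mm ι a e hL) (sfqrXf d mm ι a e hL) (qDc d mm ι e hL) (qEc d mm ι e hL) (qDf d mm ι e hL) (qEf d mm ι e hL) x.1.1 x.2.1, fun x => inLamSf d mm ι hL x.1.1 x.2.1,
    fun x => (sfInstance d mm ι hL x.1.1).gc.dist⟩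

/-- ★★★ **GUARD ∧ `N15At` AT THE (P-R) ONE-PROPAGATOR LITERAL, SOME THRESHOLD, GIVEN THE (P-R) ENTRIES' ROW `hE` AND n15-c∕211's THREE GLOBAL LANDAU ROWS `hG`** (`d ≥ 1`, odd `L ≥ 7`,
`a, c₃₅ > 0`, trace-form coordinates `e`, `ι`, `mm` nonempty): OPERATOR = n15-c∕211 `ne2PlusOperator_sfqr_of_global` (`hE`, `hG` displayed AS THERE), SITE = §2 `ne2PlusSite_foSiteAny_sfqr` (`hG`),
UNIT = §2 `ne2PlusUnit_foCovAnyLam_sfqr` (`hG`), GUARD = (Ð-5) `live_sfGELam` — ONE propagator `X_r` in (3.42), (3.48) and (3.187), ONE displayed Landau family feeding all three layers.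
[cite: Balaban1985BackgroundPropagators, Thm 3.1 (3.42) p.397, Thm 3.2 (3.47)–(3.48) p.398, Thm 3.15 (3.187) p.432 (templates: MODEL level), (3.25)–(3.26) p.395, (3.49) p.398; Balaban1985Averaging, (124)–(125) p.36] -/
theorem exists_live_and_n15At_sfObjects₇qvr [Nonempty ι] (hd : 1 ≤ d) (hL : Odd L ∧ 1 < L) (hL7 : 7 ≤ L) (ha : 0 < a) {c35 : ℝ} (hc35 : 0 < c35)
    (he : ∀ A B : Matrix mm mm ℂ, traceForm A B = e A ⬝ᵥ e B) (E : ∀ i : SfIdx d L, Fin 4 → (Fin (d + 1) → CvX' d L i.m i.kk i.r hL → Matrix mm mm ℂ) → ((CvX d L i.m i.kk hL × ι → ℝ) →ₗ[ℝ] (CvX' d L i.m i.kk i.r hL × ι → ℝ)))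
    (hE : ∃ M₁ δ₁ a₁ B₁ γ₁ : ℝ, 0 < M₁ ∧ 0 < δ₁ ∧ 0 < a₁ ∧ 0 < B₁ ∧ 0 < γ₁ ∧
      ∀ i : SfIdx d L, M₁ ≤ (L : ℝ) ^ i.m → ∀ α₀ : ℝ, 0 < α₀ → (L : ℝ) ^ i.m * α₀ ≤ a₁ →
        ∀ A' : Fin (d + 1) → CvX' d L i.m i.kk i.r hL → Matrix mm mm ℂ, (sfInstance d mm ι hL i).Bf.Reg335 c35 α₀ A' → ∀ n : Fin 4, n ≠ 0 →
          HasMaj (BlockNorm.ofBlocks (sfGeo d hL i) (liftBlk (cvBlk d L i.m i.kk hL) ι))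
            (BlockNorm.ofBlocks (sfGeo d hL i) (liftBlk (cvBlk d L i.m i.kk hL ∘ kingPrV L i.kk i.r (cvM d L i.m i.kk hL)) ι)) (E i n A')
            (fun y y' => B₁ * B9.pref4 ((opGeo (sfGeo d hL i) (CvX d L i.m i.kk hL × ι) (liftBlk (cvBlk d L i.m i.kk hL) ι)).len y) n * Real.exp (-(δ₁ * (sfGeo d hL i).dist y y')) *
              max (rateFactor (opGeo (sfGeo d hL i) (CvX d L i.m i.kk hL × ι) (liftBlk (cvBlk d L i.m i.kk hL) ι)) γ₁ y)
                (rateFactor (opGeo (sfGeo d hL i) (CvX d L i.m i.kk hL × ι) (liftBlk (cvBlk d L i.m i.kk hL) ι)) γ₁ y')))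
    (hG : ∃ δR cR CR γR : ℝ, 0 < δR ∧ 0 ≤ cR ∧ 0 ≤ CR ∧ 0 < γR ∧
      ∀ i : SfIdx d L, ∀ α₀ : ℝ, 0 < α₀ → ∀ A' : Fin (d + 1) → CvX' d L i.m i.kk i.r hL → Matrix mm mm ℂ, (sfInstance d mm ι hL i).Bf.Reg335 c35 α₀ A' →
        HasMaj (CvNorm d L i.m i.kk hL ι) (CvNorm d L i.m i.kk hL ι) (cvNVr d L i.m i.kk hL a ι e (fun μ x => NormedSpace.exp (((((L ^ i.kk : ℕ) : ℝ))⁻¹) • gavgM (Matrix mm mm ℂ) (Fin (d + 1)) (kingPrV L i.kk i.r (cvM d L i.m i.kk hL)) A' μ x))) (fun y y' => (cR * (c35 * (L : ℝ) ^ i.m * α₀)) * Real.exp (-(δR * (unitTorusGeo L i.kk (cvM d L i.m i.kk hL)).dist y y'))) ∧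
        HasMaj (BlockNorm.ofBlocks (unitTorusGeo L i.kk (cvM d L i.m i.kk hL)) (liftBlk (cvBlk d L i.m i.kk hL ∘ (kingPrV L i.kk i.r (cvM d L i.m i.kk hL))) ι)) (BlockNorm.ofBlocks (unitTorusGeo L i.kk (cvM d L i.m i.kk hL)) (liftBlk (cvBlk d L i.m i.kk hL ∘ (kingPrV L i.kk i.r (cvM d L i.m i.kk hL))) ι)) (cvNVr' d L i.m i.kk i.r hL a ι e (fun μ x' => NormedSpace.exp (((((L ^ i.r * L ^ i.kk : ℕ) : ℝ))⁻¹) • A' μ x'))) (fun y y' => (cR * (c35 * (L : ℝ) ^ i.m * α₀)) * Real.exp (-(δR * (unitTorusGeo L i.kk (cvM d L i.m i.kk hL)).dist y y'))) ∧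
        HasMaj (CvNorm d L i.m i.kk hL ι) (BlockNorm.ofBlocks (unitTorusGeo L i.kk (cvM d L i.m i.kk hL)) (liftBlk (cvBlk d L i.m i.kk hL ∘ (kingPrV L i.kk i.r (cvM d L i.m i.kk hL))) ι)) (idef (pull (liftMap (kingPrV L i.kk i.r (cvM d L i.m i.kk hL)) ι)) (pull (liftMap (kingPrV L i.kk i.r (cvM d L i.m i.kk hL)) ι)) (cvNVr' d L i.m i.kk i.r hL a ι e (fun μ x' => NormedSpace.exp (((((L ^ i.r * L ^ i.kk : ℕ) : ℝ))⁻¹) • A' μ x'))) (cvNVr d L i.m i.kk hL a ι e (fun μ x => NormedSpace.exp (((((L ^ i.kk : ℕ) : ℝ))⁻¹) • gavgM (Matrix mm mm ℂ) (Fin (d + 1)) (kingPrV L i.kk i.r (cvM d L i.m i.kk hL)) A' μ x)))) (fun y y' => (CR * ((L : ℝ) ^ i.kk) ^ (-γR)) * Real.exp (-(δR * (unitTorusGeo L i.kk (cvM d L i.m i.kk hL)).dist y y'))))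
    (α β : Fin (d + 1)) (j j' : ι) (α' β' : Fin (d + 1)) (j₂ j₂' : ι) (p : ℝ) :
    ∃ w : ℝ, Live (ne2OfRecord₁₁ (sfObjects₇qvr d mm ι a e hL E α β j j' α' β' j₂ j₂' c35 p w)) ∧
      N15At (ne2OfRecord₁₁ (sfObjects₇qvr d mm ι a e hL E α β j j' α' β' j₂ j₂' c35 p w)) := by
  obtain ⟨δR, cR, CR, γR, hδR, hcR, hCR, hγR, hG'⟩ := hG
  obtain ⟨w, hunit⟩ := ne2PlusUnit_foCovAnyLam_sfqr d mm ι a e hd hL hL7 ha hc35 he hδR hcR hCR hγR hG' α' β' j₂ j₂'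
  exact ⟨w, live_sfGELam d mm ι hL w hc35.le p _ _ _,
    ⟨ne2PlusOperator_comp (fun x : SfIdxGE d L w × RegIdx0 d => x.1.1) (ne2PlusOperator_sfqr_of_global d mm ι e hL hL7 ha hc35 he E hE ⟨δR, cR, CR, γR, hδR, hcR, hCR, hγR, hG'⟩),
      ne2PlusSite_comp (fun x : SfIdxGE d L w × RegIdx0 d => x.1.1) (ne2PlusSite_foSiteAny_sfqr d mm ι a e hL hL7 ha hc35 he hδR hcR hCR hγR hG' α β j j' 4 p),
      ne2PlusUnit_comp (fun x : SfIdxGE d L w × RegIdx0 d => ((x.1, x.2.1) : SfIdxGE d L w × Finset (Fin (d + 1) → ℤ))) hunit⟩⟩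

/-- **THE PINNED THRESHOLD** `w_Q7` of the (P-R) one-propagator literal (a `Classical.choose`; the cube floor is NOT explicit). [bookkeeping] -/
def wQ7 [Nonempty ι] (hd : 1 ≤ d) (hL : Odd L ∧ 1 < L) (hL7 : 7 ≤ L) (ha : 0 < a) {c35 : ℝ} (hc35 : 0 < c35) (he : ∀ A B : Matrix mm mm ℂ, traceForm A B = e A ⬝ᵥ e B)
    (E : ∀ i : SfIdx d L, Fin 4 → (Fin (d + 1) → CvX' d L i.m i.kk i.r hL → Matrix mm mm ℂ) → ((CvX d L i.m i.kk hL × ι → ℝ) →ₗ[ℝ] (CvX' d L i.m i.kk i.r hL × ι → ℝ)))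
    (hE : ∃ M₁ δ₁ a₁ B₁ γ₁ : ℝ, 0 < M₁ ∧ 0 < δ₁ ∧ 0 < a₁ ∧ 0 < B₁ ∧ 0 < γ₁ ∧
      ∀ i : SfIdx d L, M₁ ≤ (L : ℝ) ^ i.m → ∀ α₀ : ℝ, 0 < α₀ → (L : ℝ) ^ i.m * α₀ ≤ a₁ →
        ∀ A' : Fin (d + 1) → CvX' d L i.m i.kk i.r hL → Matrix mm mm ℂ, (sfInstance d mm ι hL i).Bf.Reg335 c35 α₀ A' → ∀ n : Fin 4, n ≠ 0 →
          HasMaj (BlockNorm.ofBlocks (sfGeo d hL i) (liftBlk (cvBlk d L i.m i.kk hL) ι))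
            (BlockNorm.ofBlocks (sfGeo d hL i) (liftBlk (cvBlk d L i.m i.kk hL ∘ kingPrV L i.kk i.r (cvM d L i.m i.kk hL)) ι)) (E i n A')
            (fun y y' => B₁ * B9.pref4 ((opGeo (sfGeo d hL i) (CvX d L i.m i.kk hL × ι) (liftBlk (cvBlk d L i.m i.kk hL) ι)).len y) n * Real.exp (-(δ₁ * (sfGeo d hL i).dist y y')) *
              max (rateFactor (opGeo (sfGeo d hL i) (CvX d L i.m i.kk hL × ι) (liftBlk (cvBlk d L i.m i.kk hL) ι)) γ₁ y)
                (rateFactor (opGeo (sfGeo d hL i) (CvX d L i.m i.kk hL × ι) (liftBlk (cvBlk d L i.m i.kk hL) ι)) γ₁ y')))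
    (hG : ∃ δR cR CR γR : ℝ, 0 < δR ∧ 0 ≤ cR ∧ 0 ≤ CR ∧ 0 < γR ∧
      ∀ i : SfIdx d L, ∀ α₀ : ℝ, 0 < α₀ → ∀ A' : Fin (d + 1) → CvX' d L i.m i.kk i.r hL → Matrix mm mm ℂ, (sfInstance d mm ι hL i).Bf.Reg335 c35 α₀ A' →
        HasMaj (CvNorm d L i.m i.kk hL ι) (CvNorm d L i.m i.kk hL ι) (cvNVr d L i.m i.kk hL a ι e (fun μ x => NormedSpace.exp (((((L ^ i.kk : ℕ) : ℝ))⁻¹) • gavgM (Matrix mm mm ℂ) (Fin (d + 1)) (kingPrV L i.kk i.r (cvM d L i.m i.kk hL)) A' μ x))) (fun y y' => (cR * (c35 * (L : ℝ) ^ i.m * α₀)) * Real.exp (-(δR * (unitTorusGeo L i.kk (cvM d L i.m i.kk hL)).dist y y'))) ∧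
        HasMaj (BlockNorm.ofBlocks (unitTorusGeo L i.kk (cvM d L i.m i.kk hL)) (liftBlk (cvBlk d L i.m i.kk hL ∘ (kingPrV L i.kk i.r (cvM d L i.m i.kk hL))) ι)) (BlockNorm.ofBlocks (unitTorusGeo L i.kk (cvM d L i.m i.kk hL)) (liftBlk (cvBlk d L i.m i.kk hL ∘ (kingPrV L i.kk i.r (cvM d L i.m i.kk hL))) ι)) (cvNVr' d L i.m i.kk i.r hL a ι e (fun μ x' => NormedSpace.exp (((((L ^ i.r * L ^ i.kk : ℕ) : ℝ))⁻¹) • A' μ x'))) (fun y y' => (cR * (c35 * (L : ℝ) ^ i.m * α₀)) * Real.exp (-(δR * (unitTorusGeo L i.kk (cvM d L i.m i.kk hL)).dist y y'))) ∧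
        HasMaj (CvNorm d L i.m i.kk hL ι) (BlockNorm.ofBlocks (unitTorusGeo L i.kk (cvM d L i.m i.kk hL)) (liftBlk (cvBlk d L i.m i.kk hL ∘ (kingPrV L i.kk i.r (cvM d L i.m i.kk hL))) ι)) (idef (pull (liftMap (kingPrV L i.kk i.r (cvM d L i.m i.kk hL)) ι)) (pull (liftMap (kingPrV L i.kk i.r (cvM d L i.m i.kk hL)) ι)) (cvNVr' d L i.m i.kk i.r hL a ι e (fun μ x' => NormedSpace.exp (((((L ^ i.r * L ^ i.kk : ℕ) : ℝ))⁻¹) • A' μ x'))) (cvNVr d L i.m i.kk hL a ι e (fun μ x => NormedSpace.exp (((((L ^ i.kk : ℕ) : ℝ))⁻¹) • gavgM (Matrix mm mm ℂ) (Fin (d + 1)) (kingPrV L i.kk i.r (cvM d L i.m i.kk hL)) A' μ x)))) (fun y y' => (CR * ((L : ℝ) ^ i.kk) ^ (-γR)) * Real.exp (-(δR * (unitTorusGeo L i.kk (cvM d L i.m i.kk hL)).dist y y'))))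
    (α β : Fin (d + 1)) (j j' : ι) (α' β' : Fin (d + 1)) (j₂ j₂' : ι) (p : ℝ) : ℝ :=
  Classical.choose (exists_live_and_n15At_sfObjects₇qvr d mm ι a e hd hL hL7 ha hc35 he E hE hG α β j j' α' β' j₂ j₂' p)

/-- ★★★ **GUARD ∧ `N15At` AT THE (P-R) ONE-PROPAGATOR LITERAL PINNED AT `w_Q7`** — the lane's most print-faithful `Live ∧ N15At`: ONE model propagator `G(U) = X_r` with Bałaban's WHOLE
covariant summand `a·Q*(U)Q(U) − D_U(I − R(U))D*_U` live, read by (3.42), (3.48) and (3.187) alike, covariant averaging in the sandwich, genuine Dirichlet region — MODULO the displayed (P-R)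
entries' row `hE` and n15-c∕211's three global Landau rows `hG`; MODEL carriers. [cite: Balaban1985BackgroundPropagators, (3.42) p.397, Thms 3.1∕3.2 p.398, Thm 3.15 p.432, (3.25)–(3.26) p.395 (shape)] -/
theorem live_and_n15At_sfObjects₇qvr_wQ7 [Nonempty ι] (hd : 1 ≤ d) (hL : Odd L ∧ 1 < L) (hL7 : 7 ≤ L) (ha : 0 < a) {c35 : ℝ} (hc35 : 0 < c35)
    (he : ∀ A B : Matrix mm mm ℂ, traceForm A B = e A ⬝ᵥ e B) (E : ∀ i : SfIdx d L, Fin 4 → (Fin (d + 1) → CvX' d L i.m i.kk i.r hL → Matrix mm mm ℂ) → ((CvX d L i.m i.kk hL × ι → ℝ) →ₗ[ℝ] (CvX' d L i.m i.kk i.r hL × ι → ℝ)))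
    (hE : ∃ M₁ δ₁ a₁ B₁ γ₁ : ℝ, 0 < M₁ ∧ 0 < δ₁ ∧ 0 < a₁ ∧ 0 < B₁ ∧ 0 < γ₁ ∧
      ∀ i : SfIdx d L, M₁ ≤ (L : ℝ) ^ i.m → ∀ α₀ : ℝ, 0 < α₀ → (L : ℝ) ^ i.m * α₀ ≤ a₁ →
        ∀ A' : Fin (d + 1) → CvX' d L i.m i.kk i.r hL → Matrix mm mm ℂ, (sfInstance d mm ι hL i).Bf.Reg335 c35 α₀ A' → ∀ n : Fin 4, n ≠ 0 →
          HasMaj (BlockNorm.ofBlocks (sfGeo d hL i) (liftBlk (cvBlk d L i.m i.kk hL) ι))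
            (BlockNorm.ofBlocks (sfGeo d hL i) (liftBlk (cvBlk d L i.m i.kk hL ∘ kingPrV L i.kk i.r (cvM d L i.m i.kk hL)) ι)) (E i n A')
            (fun y y' => B₁ * B9.pref4 ((opGeo (sfGeo d hL i) (CvX d L i.m i.kk hL × ι) (liftBlk (cvBlk d L i.m i.kk hL) ι)).len y) n * Real.exp (-(δ₁ * (sfGeo d hL i).dist y y')) *
              max (rateFactor (opGeo (sfGeo d hL i) (CvX d L i.m i.kk hL × ι) (liftBlk (cvBlk d L i.m i.kk hL) ι)) γ₁ y)
                (rateFactor (opGeo (sfGeo d hL i) (CvX d L i.m i.kk hL × ι) (liftBlk (cvBlk d L i.m i.kk hL) ι)) γ₁ y')))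
    (hG : ∃ δR cR CR γR : ℝ, 0 < δR ∧ 0 ≤ cR ∧ 0 ≤ CR ∧ 0 < γR ∧
      ∀ i : SfIdx d L, ∀ α₀ : ℝ, 0 < α₀ → ∀ A' : Fin (d + 1) → CvX' d L i.m i.kk i.r hL → Matrix mm mm ℂ, (sfInstance d mm ι hL i).Bf.Reg335 c35 α₀ A' →
        HasMaj (CvNorm d L i.m i.kk hL ι) (CvNorm d L i.m i.kk hL ι) (cvNVr d L i.m i.kk hL a ι e (fun μ x => NormedSpace.exp (((((L ^ i.kk : ℕ) : ℝ))⁻¹) • gavgM (Matrix mm mm ℂ) (Fin (d + 1)) (kingPrV L i.kk i.r (cvM d L i.m i.kk hL)) A' μ x))) (fun y y' => (cR * (c35 * (L : ℝ) ^ i.m * α₀)) * Real.exp (-(δR * (unitTorusGeo L i.kk (cvM d L i.m i.kk hL)).dist y y'))) ∧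
        HasMaj (BlockNorm.ofBlocks (unitTorusGeo L i.kk (cvM d L i.m i.kk hL)) (liftBlk (cvBlk d L i.m i.kk hL ∘ (kingPrV L i.kk i.r (cvM d L i.m i.kk hL))) ι)) (BlockNorm.ofBlocks (unitTorusGeo L i.kk (cvM d L i.m i.kk hL)) (liftBlk (cvBlk d L i.m i.kk hL ∘ (kingPrV L i.kk i.r (cvM d L i.m i.kk hL))) ι)) (cvNVr' d L i.m i.kk i.r hL a ι e (fun μ x' => NormedSpace.exp (((((L ^ i.r * L ^ i.kk : ℕ) : ℝ))⁻¹) • A' μ x'))) (fun y y' => (cR * (c35 * (L : ℝ) ^ i.m * α₀)) * Real.exp (-(δR * (unitTorusGeo L i.kk (cvM d L i.m i.kk hL)).dist y y'))) ∧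
        HasMaj (CvNorm d L i.m i.kk hL ι) (BlockNorm.ofBlocks (unitTorusGeo L i.kk (cvM d L i.m i.kk hL)) (liftBlk (cvBlk d L i.m i.kk hL ∘ (kingPrV L i.kk i.r (cvM d L i.m i.kk hL))) ι)) (idef (pull (liftMap (kingPrV L i.kk i.r (cvM d L i.m i.kk hL)) ι)) (pull (liftMap (kingPrV L i.kk i.r (cvM d L i.m i.kk hL)) ι)) (cvNVr' d L i.m i.kk i.r hL a ι e (fun μ x' => NormedSpace.exp (((((L ^ i.r * L ^ i.kk : ℕ) : ℝ))⁻¹) • A' μ x'))) (cvNVr d L i.m i.kk hL a ι e (fun μ x => NormedSpace.exp (((((L ^ i.kk : ℕ) : ℝ))⁻¹) • gavgM (Matrix mm mm ℂ) (Fin (d + 1)) (kingPrV L i.kk i.r (cvM d L i.m i.kk hL)) A' μ x)))) (fun y y' => (CR * ((L : ℝ) ^ i.kk) ^ (-γR)) * Real.exp (-(δR * (unitTorusGeo L i.kk (cvM d L i.m i.kk hL)).dist y y'))))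
    (α β : Fin (d + 1)) (j j' : ι) (α' β' : Fin (d + 1)) (j₂ j₂' : ι) (p : ℝ) :
    Live (ne2OfRecord₁₁ (sfObjects₇qvr d mm ι a e hL E α β j j' α' β' j₂ j₂' c35 p (wQ7 d mm ι a e hd hL hL7 ha hc35 he E hE hG α β j j' α' β' j₂ j₂' p))) ∧
      N15At (ne2OfRecord₁₁ (sfObjects₇qvr d mm ι a e hL E α β j j' α' β' j₂ j₂' c35 p (wQ7 d mm ι a e hd hL hL7 ha hc35 he E hE hG α β j j' α' β' j₂ j₂' p))) :=
  Classical.choose_spec (exists_live_and_n15At_sfObjects₇qvr d mm ι a e hd hL hL7 ha hc35 he E hE hG α β j j' α' β' j₂ j₂' p)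

variable {N : ℕ} [NeZero N] {key : (F : T4Family) → Datum F N → Prop}

/-- ★★ **THE (P-R) ONE-PROPAGATOR LITERAL AT ANY KEYED HOME** (part 30's interface; `ne2At` a BINDER, `hadm` AND the value equation `h` hypotheses — no pin, no v8): a rate home over ANY key
admitting only the literals of a key-indexed NE2 reading whose value everywhere is the pinned (P-R) one-propagator literal has `S_N15 RRec` — modulo `hE`, `hG`. [bookkeeping] -/
theorem s_N15_of_admits_sf₇qvr [Nonempty ι] (hd : 1 ≤ d) (hL : Odd L ∧ 1 < L) (hL7 : 7 ≤ L) (ha : 0 < a) {c35 : ℝ} (hc35 : 0 < c35)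
    (he : ∀ A B : Matrix mm mm ℂ, traceForm A B = e A ⬝ᵥ e B) (E : ∀ i : SfIdx d L, Fin 4 → (Fin (d + 1) → CvX' d L i.m i.kk i.r hL → Matrix mm mm ℂ) → ((CvX d L i.m i.kk hL × ι → ℝ) →ₗ[ℝ] (CvX' d L i.m i.kk i.r hL × ι → ℝ)))
    (hE : ∃ M₁ δ₁ a₁ B₁ γ₁ : ℝ, 0 < M₁ ∧ 0 < δ₁ ∧ 0 < a₁ ∧ 0 < B₁ ∧ 0 < γ₁ ∧
      ∀ i : SfIdx d L, M₁ ≤ (L : ℝ) ^ i.m → ∀ α₀ : ℝ, 0 < α₀ → (L : ℝ) ^ i.m * α₀ ≤ a₁ →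
        ∀ A' : Fin (d + 1) → CvX' d L i.m i.kk i.r hL → Matrix mm mm ℂ, (sfInstance d mm ι hL i).Bf.Reg335 c35 α₀ A' → ∀ n : Fin 4, n ≠ 0 →
          HasMaj (BlockNorm.ofBlocks (sfGeo d hL i) (liftBlk (cvBlk d L i.m i.kk hL) ι))
            (BlockNorm.ofBlocks (sfGeo d hL i) (liftBlk (cvBlk d L i.m i.kk hL ∘ kingPrV L i.kk i.r (cvM d L i.m i.kk hL)) ι)) (E i n A')
            (fun y y' => B₁ * B9.pref4 ((opGeo (sfGeo d hL i) (CvX d L i.m i.kk hL × ι) (liftBlk (cvBlk d L i.m i.kk hL) ι)).len y) n * Real.exp (-(δ₁ * (sfGeo d hL i).dist y y')) *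
              max (rateFactor (opGeo (sfGeo d hL i) (CvX d L i.m i.kk hL × ι) (liftBlk (cvBlk d L i.m i.kk hL) ι)) γ₁ y)
                (rateFactor (opGeo (sfGeo d hL i) (CvX d L i.m i.kk hL × ι) (liftBlk (cvBlk d L i.m i.kk hL) ι)) γ₁ y')))
    (hG : ∃ δR cR CR γR : ℝ, 0 < δR ∧ 0 ≤ cR ∧ 0 ≤ CR ∧ 0 < γR ∧
      ∀ i : SfIdx d L, ∀ α₀ : ℝ, 0 < α₀ → ∀ A' : Fin (d + 1) → CvX' d L i.m i.kk i.r hL → Matrix mm mm ℂ, (sfInstance d mm ι hL i).Bf.Reg335 c35 α₀ A' →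
        HasMaj (CvNorm d L i.m i.kk hL ι) (CvNorm d L i.m i.kk hL ι) (cvNVr d L i.m i.kk hL a ι e (fun μ x => NormedSpace.exp (((((L ^ i.kk : ℕ) : ℝ))⁻¹) • gavgM (Matrix mm mm ℂ) (Fin (d + 1)) (kingPrV L i.kk i.r (cvM d L i.m i.kk hL)) A' μ x))) (fun y y' => (cR * (c35 * (L : ℝ) ^ i.m * α₀)) * Real.exp (-(δR * (unitTorusGeo L i.kk (cvM d L i.m i.kk hL)).dist y y'))) ∧
        HasMaj (BlockNorm.ofBlocks (unitTorusGeo L i.kk (cvM d L i.m i.kk hL)) (liftBlk (cvBlk d L i.m i.kk hL ∘ (kingPrV L i.kk i.r (cvM d L i.m i.kk hL))) ι)) (BlockNorm.ofBlocks (unitTorusGeo L i.kk (cvM d L i.m i.kk hL)) (liftBlk (cvBlk d L i.m i.kk hL ∘ (kingPrV L i.kk i.r (cvM d L i.m i.kk hL))) ι)) (cvNVr' d L i.m i.kk i.r hL a ι e (fun μ x' => NormedSpace.exp (((((L ^ i.r * L ^ i.kk : ℕ) : ℝ))⁻¹) • A' μ x'))) (fun y y' => (cR * (c35 * (L : ℝ)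 ^ i.m * α₀)) * Real.exp (-(δR * (unitTorusGeo L i.kk (cvM d L i.m i.kk hL)).dist y y'))) ∧
        HasMaj (CvNorm d L i.m i.kk hL ι) (BlockNorm.ofBlocks (unitTorusGeo L i.kk (cvM d L i.m i.kk hL)) (liftBlk (cvBlk d L i.m i.kk hL ∘ (kingPrV L i.kk i.r (cvM d L i.m i.kk hL))) ι)) (idef (pull (liftMap (kingPrV L i.kk i.r (cvM d L i.m i.kk hL)) ι)) (pull (liftMap (kingPrV L i.kk i.r (cvM d L i.m i.kk hL)) ι)) (cvNVr' d L i.m i.kk i.r hL a ι e (fun μ x' => NormedSpace.exp (((((L ^ i.r * L ^ i.kk : ℕ) : ℝ))⁻¹) • A' μ x'))) (cvNVr d L i.m i.kk hL a ι e (fun μ x => NormedSpace.exp (((((L ^ i.kk : ℕ) : ℝ))⁻¹) • gavgM (Matrix mm mm ℂ) (Fin (d + 1)) (kingPrV L i.kk i.r (cvM d L i.m i.kk hL)) A' μ x)))) (fun y y' => (CR * ((L : ℝ) ^ i.kk) ^ (-γR)) * Real.exp (-(δR * (unitTorusGeo L i.kk (cvM d L i.m i.kk hL)).dist y y'))))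
    (α β : Fin (d + 1)) (j j' : ι) (α' β' : Fin (d + 1)) (j₂ j₂' : ι) (p : ℝ)
    (ne2At : ∀ {F : T4Family} {D : Datum F N}, key F D → (ℕ → ℝ) → List (ULoop F) → ℕ → NE2Objects₁₁) (RRec : RateRecordPred N)
    (hadm : ∀ (F : T4Family) (D : Datum F N) (g₀ : ℕ → ℝ) (os : List (ULoop F)) (R : RateCarriers N), RRec F D g₀ os R →
      ∃ (h : key F D) (k : ℕ), R.ne2 = ne2OfRecord₁₁ (ne2At h g₀ os k))
    (h : ∀ (F : T4Family) (D : Datum F N) (h : key F D) (g₀ : ℕ → ℝ) (os : List (ULoop F)) (k : ℕ),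
      ne2At h g₀ os k = sfObjects₇qvr d mm ι a e hL E α β j j' α' β' j₂ j₂' c35 p (wQ7 d mm ι a e hd hL hL7 ha hc35 he E hE hG α β j j' α' β' j₂ j₂' p)) :
    S_N15 RRec :=
  s_N15_of_admits ne2At RRec hadm fun F D hk g₀ os k => by
    rw [h F D hk g₀ os k]
    exact (live_and_n15At_sfObjects₇qvr_wQ7 d mm ι a e hd hL hL7 ha hc35 he E hE hG α β j j' α' β' j₂ j₂' p).2

end Closed

end Summit.QuantumFields.YangMills.BalabanUVNodes.N15.SiteLayerSf

end
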